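import Summits.CriticalPhenomena.SAWScalingLimit.Theses.SAWDefectDecoherence
import Literature.Topology.PlaneTopology.Crosscut

/-!
# Pick engine helper (line `pick-half-plane`, stub `stub_pickEngine`): re-marking the root

Support file for crux `BoundaryClosureR` (stmt-CriticalPhenomena-14004), line `pick-half-plane`,
stub `stub_pickEngine` (`DevelopingMapExact → HalfPlaneBounds → GateMassLaws → LocalL1Bound →
DefectDecoherence → MassRatio → PickCupLimits`).

The conclusion `PickCupLimits` of the engine quantifies over an ARBITRARY pinned flat root
`x ≠ D.pt 1` of the Dobrushin domain `D` (root family `e δ → x`), whereas the route crux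
`MassRatio` (and the node `ConjugateClassNegligible`) is stated for a root family converging to the
FIRST MARKED POINT `D.pt 0`.  To consume `MassRatio` at a general pinned root the engine must
re-mark the domain: same carrier, same second marked point, first marked point moved to `x`.
This file provides exactly that (pure bookkeeping on `MarkedDomain 2`, no analysis):

* `mem_frontier_of_flat_piece` — a point `x` at which the domain is locally the open upper
  half-disc (`D.carrier ∩ ball x r = {im > im x} ∩ ball x r`, the pin of the target frame) is a
  frontier point of the carrier and not a point of it;
* `exists_dobrushinDomain_pt_zero_eq` — for every frontier point `x ≠ D.pt 1` there is a
  Dobrushin domain `D'` with `D'.carrier = D.carrier`, `D'.pt 0 = x`, `D'.pt 1 = D.pt 1`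
  (re-base the boundary loop at a parameter of `x`, second mark = `fract (mark 1 - t₀)`);
* `massRatio_at_pinned_root` — `MassRatio` transported to every pinned flat root `x ≠ D.pt 1` of
  an admissible family (hypotheses = the line's `AdmissibleFamily`/`PinnedFlatRoot`, unfolded).

No new definitions.  References: Werner, *Lectures on two-dimensional critical percolation*
(2007), §2 (domains with marked boundary points); Duminil-Copin–Smirnov, Ann. of Math. 175 (2012)
(the observable).
-/

noncomputable section

open scoped Topology
open Filter Set Metric
open Literature.Probability.LatticeModels Literature.Probability.RandomPlanarGeometry
open Literature.Probability.RandomPlanarGeometry.SAW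
open Summit.CriticalPhenomena.SAWScalingLimit.Theses.SAWDefectDecoherence

namespace Summit.CriticalPhenomena.SAWScalingLimit.Theorems.PickHalfPlane.Engine

/-- A pinned flat point is a boundary point: if inside `ball x r` (`r > 0`) the domain is exactly
the open half-disc above `x`, then `x ∉ D.carrier` and `x ∈ frontier D.carrier` (the points
`x + it`, `0 < t < r`, of the domain converge to `x`). [folklore] -/
theorem mem_frontier_of_flat_piece (D : DobrushinDomain) {x : ℂ} {r : ℝ} (hr : 0 < r)
    (hflat : D.carrier ∩ ball x r = {z : ℂ | x.im < z.im} ∩ ball x r) :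
    x ∈ frontier D.carrier ∧ x ∉ D.carrier := by
  have hxnot : x ∉ D.carrier := by
    intro hx
    have : x ∈ {z : ℂ | x.im < z.im} ∩ ball x r := by
      rw [← hflat]; exact ⟨hx, mem_ball_self hr⟩
    exact lt_irrefl x.im (by simpa using this.1)
  refine ⟨?_, hxnot⟩
  rw [frontier_eq_closure_inter_closure]
  refine ⟨?_, subset_closure hxnot⟩
  -- `x + i t → x` as `t → 0⁺`, through points of the domain
  have hlim : Tendsto (fun t : ℝ => x + (t : ℂ) * Complex.I) (𝓝[>] 0) (𝓝 x) := by
    have : Tendsto (fun t : ℝ => x + (t : ℂ) * Complex.I) (𝓝 0) (𝓝 (x + (0 : ℝ) * Complex.I)) :=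
      ((Complex.continuous_ofReal.tendsto 0).mul tendsto_const_nhds).const_add x
    simpa using this.mono_left nhdsWithin_le_nhds
  refine mem_closure_of_tendsto hlim ?_
  have hIoo : Ioo (0 : ℝ) r ∈ 𝓝[>] (0 : ℝ) := Ioo_mem_nhdsGT hr
  filter_upwards [hIoo] with t ht
  have hmem : x + (t : ℂ) * Complex.I ∈ {z : ℂ | x.im < z.im} ∩ ball x r := by
    refine ⟨?_, ?_⟩
    · simp [ht.1]
    · rw [mem_ball, dist_eq_norm]
      have : x + (t : ℂ) * Complex.I - x = (t : ℂ) * Complex.I := by ring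
      rw [this, norm_mul, Complex.norm_real, Complex.norm_I, mul_one, Real.norm_eq_abs,
        abs_of_pos ht.1]
      exact ht.2
  rw [← hflat] at hmem
  exact hmem.1

/-- **Re-marking a Dobrushin domain at a frontier point.** For every frontier point `x` of the
carrier other than the second marked point there is a Dobrushin domain with the same carrier,
first marked point `x` and the same second marked point: re-base the `1`-periodic boundary loop at
a parameter `t₀ ∈ [0,1)` of `x` (`t ↦ ∂D (t + t₀)`, injective on `[0,1)` by
`JordanDomain.injOn_boundary_Ico`) and take the marks `0` and `fract (mark 1 - t₀) ∈ (0,1)`.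
(Werner 2007, §2: a Dobrushin domain is a Jordan domain with any two distinct boundary points
marked.) [folklore] -/
theorem exists_dobrushinDomain_pt_zero_eq (D : DobrushinDomain) {x : ℂ}
    (hx : x ∈ frontier D.carrier) (hx1 : x ≠ D.pt 1) :
    ∃ D' : DobrushinDomain, D'.carrier = D.carrier ∧ D'.pt 0 = x ∧ D'.pt 1 = D.pt 1 := by
  rw [D.frontier_eq_image_Ico] at hx
  obtain ⟨t₀, ht₀, rfl⟩ := hx
  set σ : ℝ := Int.fract (D.mark 1 - t₀) with hσdef
  have hσ1 : σ < 1 := Int.fract_lt_one _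
  have hσ0 : 0 < σ := by
    rcases (Int.fract_nonneg (D.mark 1 - t₀)).lt_or_eq with h | h
    · exact h
    · exfalso
      apply hx1
      obtain ⟨-, -, z, hz⟩ := Int.fract_eq_iff.1 h.symm
      rw [sub_zero] at hz
      have hm := D.mark_mem 1
      have hlt : |D.mark 1 - t₀| < 1 := by
        rw [abs_lt]; constructor <;> linarith [hm.1, hm.2, ht₀.1, ht₀.2]
      rw [hz] at hlt
      have hz0 : z = 0 := by
        have : |z| < 1 := by exact_mod_cast hlt
        exact Int.abs_lt_one_iff.1 this
      rw [hz0, Int.cast_zero, sub_eq_zero] at hz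
      simp only [MarkedDomain.pt, hz]
  refine ⟨{ carrier := D.carrier
            boundary := fun s => D.boundary (s + t₀)
            isOpen := D.isOpen
            isBounded := D.isBounded
            isConnected := D.isConnected
            continuous_boundary := D.continuous_boundary.comp (continuous_id.add continuous_const)
            periodic_boundary := D.periodic_boundary.add_const _
            injOn_boundary := fun s hs t ht hst =>
              add_right_cancel (D.injOn_boundary_Ico t₀
                (show s + t₀ ∈ Ico t₀ (t₀ + 1) from ⟨by linarith [hs.1], by linarith [hs.2]⟩)
                (show t + t₀ ∈ Ico t₀ (t₀ + 1) from ⟨by linarith [ht.1], by linarith [ht.2]⟩)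
                (show D.boundary (s + t₀) = D.boundary (t + t₀) from hst))
            range_boundary := by
              rw [show (fun s => D.boundary (s + t₀)) = D.boundary ∘ fun s => s + t₀ from rfl,
                (add_right_surjective _).range_comp]
              exact D.range_boundary
            mark := ![0, σ]
            strictMono_mark := by
              refine Fin.strictMono_iff_lt_succ.2 fun k => ?_
              fin_cases k
              simpa using hσ0
            mark_mem := fun k => by
              fin_cases k
              · simp
              · simp only [Fin.mk_one, Matrix.cons_val_one, Matrix.cons_val_zero, mem_Ico]
                exact ⟨hσ0.le, hσ1⟩ }, rfl, ?_, ?_⟩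
  · simp [MarkedDomain.pt]
  · simp only [MarkedDomain.pt, Matrix.cons_val_one, Matrix.cons_val_zero]
    rw [hσdef, ← Int.self_sub_floor, show D.mark 1 - t₀ - (⌊D.mark 1 - t₀⌋ : ℝ) + t₀ =
      D.mark 1 - (⌊D.mark 1 - t₀⌋ : ℤ) * (1 : ℝ) by ring]
    exact D.periodic_boundary.sub_int_mul_eq _

/-- **`MassRatio` at every pinned flat root.** The route crux `MassRatio` (positive-mass
comparison `δ² Σ_{δ·mid z ∈ K} Z_δ(z) ≤ C δ^{-3/4} Z_δ(b_δ)` on compacts, root family converging to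
`D.pt 0`) holds verbatim for the root family `e δ → x` of ANY pinned flat root `x ≠ D.pt 1` of an
admissible family: the hypotheses are the line's `AdmissibleFamily D ρ Λ m b` and
`PinnedFlatRoot D Λ b x e r mr` (unfolded), and the proof re-marks the domain at `x`
(`exists_dobrushinDomain_pt_zero_eq`), all hypotheses of `MassRatio` being statements about the
carrier and the second marked point only. [folklore] -/
theorem massRatio_at_pinned_root :
    MassRatio → ∀ (D : DobrushinDomain) (ρ : ℝ) (Λ : ℝ → Finset HexVertex) (m : ℝ → ℤ)
      (b : ℝ → Sym2 HexVertex),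
    (0 < ρ ∧
      D.carrier ∩ Metric.ball (D.pt 1) ρ = {z : ℂ | (D.pt 1).im < z.im} ∩ Metric.ball (D.pt 1) ρ ∧
      (∀ᶠ δ : ℝ in 𝓝[>] 0, hexDomainSimplyConnected (Λ δ) ∧ b δ ∈ hexDomainBoundary (Λ δ) ∧
        (hexGraph.induce ((Λ δ : Finset HexVertex) : Set HexVertex)).Preconnected ∧
        (∀ v ∈ Λ δ, (δ : ℂ) * hexCenter v ∈ D.carrier) ∧
        (∀ v : HexVertex, (δ : ℂ) * hexCenter v ∈ Metric.ball (D.pt 1) ρ →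
          (v ∈ Λ δ ↔ m δ ≤ v.1 1))) ∧
      (∀ K : Set ℂ, IsCompact K → K ⊆ D.carrier →
        ∀ᶠ δ : ℝ in 𝓝[>] 0, ∀ v : HexVertex, (δ : ℂ) * hexCenter v ∈ K → v ∈ Λ δ) ∧
      Tendsto (fun δ : ℝ => (δ : ℂ) * hexMidpoint (b δ)) (𝓝[>] 0) (𝓝 (D.pt 1))) →
    ∀ (x : ℂ) (e : ℝ → Sym2 HexVertex) (r : ℝ) (mr : ℝ → ℤ),
    (0 < r ∧
      D.carrier ∩ Metric.ball x r = {z : ℂ | x.im < z.im} ∩ Metric.ball x r ∧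
      (∀ᶠ δ : ℝ in 𝓝[>] 0, e δ ∈ hexDomainBoundary (Λ δ) ∧
        Nonempty (HexMidEdgeSAW (Λ δ) (e δ) (b δ)) ∧
        (∀ v : HexVertex, (δ : ℂ) * hexCenter v ∈ Metric.ball x r → (v ∈ Λ δ ↔ mr δ ≤ v.1 1))) ∧
      Tendsto (fun δ : ℝ => (δ : ℂ) * hexMidpoint (e δ)) (𝓝[>] 0) (𝓝 x)) →
    x ≠ D.pt 1 →
    ∀ K : Set ℂ, IsCompact K → K ⊆ D.carrier → ∃ C : ℝ, ∀ᶠ δ : ℝ in 𝓝[>] 0,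
      δ ^ 2 * (∑ᶠ z ∈ {z : Sym2 HexVertex | z ∈ hexDomainMidEdges (Λ δ) ∧
          (δ : ℂ) * hexMidpoint z ∈ K},
        ‖hexParafermionicObservable (Λ δ) (e δ) hexCriticalFugacity 0 z‖) ≤
      C * δ ^ (-(3 : ℝ) / 4) *
        ‖hexParafermionicObservable (Λ δ) (e δ) hexCriticalFugacity 0 (b δ)‖ := by
  intro hMR D ρ Λ m b hAF x e r mr hPR hx
  obtain ⟨hρ, hflat1, hadm, hexh, hb⟩ := hAF
  obtain ⟨hr, hflatx, hroot, he⟩ := hPR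
  obtain ⟨hxfr, -⟩ := mem_frontier_of_flat_piece D hr hflatx
  obtain ⟨D', hcar, h0, h1⟩ := exists_dobrushinDomain_pt_zero_eq D hxfr hx
  intro K hK hKD
  have hadm' : ∀ᶠ δ : ℝ in 𝓝[>] 0, hexDomainSimplyConnected (Λ δ) ∧
      e δ ∈ hexDomainBoundary (Λ δ) ∧ b δ ∈ hexDomainBoundary (Λ δ) ∧
      Nonempty (HexMidEdgeSAW (Λ δ) (e δ) (b δ)) ∧
      (hexGraph.induce ((Λ δ : Finset HexVertex) : Set HexVertex)).Preconnected ∧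
      (∀ v ∈ Λ δ, (δ : ℂ) * hexCenter v ∈ D'.carrier) ∧
      (∀ v : HexVertex, (δ : ℂ) * hexCenter v ∈ Metric.ball (D'.pt 1) ρ →
        (v ∈ Λ δ ↔ m δ ≤ v.1 1)) := by
    filter_upwards [hadm, hroot] with δ hδ hδ'
    rw [hcar, h1]
    exact ⟨hδ.1, hδ'.1, hδ.2.1, hδ'.2.1, hδ.2.2.1, hδ.2.2.2.1, hδ.2.2.2.2⟩
  have hflat1' : D'.carrier ∩ Metric.ball (D'.pt 1) ρ =
      {z : ℂ | (D'.pt 1).im < z.im} ∩ Metric.ball (D'.pt 1) ρ := by rw [hcar, h1]; exact hflat1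
  have hexh' : ∀ K : Set ℂ, IsCompact K → K ⊆ D'.carrier →
      ∀ᶠ δ : ℝ in 𝓝[>] 0, ∀ v : HexVertex, (δ : ℂ) * hexCenter v ∈ K → v ∈ Λ δ := by
    rw [hcar]; exact hexh
  have he' : Tendsto (fun δ : ℝ => (δ : ℂ) * hexMidpoint (e δ)) (𝓝[>] 0) (𝓝 (D'.pt 0)) := by
    rw [h0]; exact he
  have hb' : Tendsto (fun δ : ℝ => (δ : ℂ) * hexMidpoint (b δ)) (𝓝[>] 0) (𝓝 (D'.pt 1)) := by
    rw [h1]; exact hb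
  have hKD' : K ⊆ D'.carrier := by rw [hcar]; exact hKD
  exact hMR D' ρ Λ m e b hρ hflat1' hadm' hexh' he' hb' K hK hKD'

end Summit.CriticalPhenomena.SAWScalingLimit.Theorems.PickHalfPlane.Engine

end
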